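import Literature.MathematicalPhysics.StatisticalMechanics.SquareLatticeEdgeIsoperimetry
import HarnessLib

/-!
# The discrete Winterbottom problem in the square lattice: the on-lattice energy law
# `2(F_β + 2N) ≥ m_β(N) = min {2h + 2(1−β)l : hl ≥ N}` and its minimizers
# (Friedrich–Kreutz–Stefanelli 2025), PROVED

Topic `Literature/MathematicalPhysics/StatisticalMechanics`, sequel to `SquareLatticeEdgeIsoperimetry.lean`
(the edge-isoperimetric problem in `ℤ²`: rows-and-columns counting, line-convex sets).  Cell
`crystal3d-full` (D-0046), literature-typing layer D-0088 (4) "recent-theorem harvest", seat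
`littype-FC1-1` (gen 2).  Everything below is a theorem; no named facts.

## Source, as printed

**[FKS25]** M. Friedrich, L. Kreutz, U. Stefanelli, *Crystallization in the Winterbottom shape and
sharp fluctuation laws*, arXiv:2509.05642 (v1, 6 Sep 2025) [FriedrichKreutzStefanelli2025] (store key
`paper:arxiv-2509.05642`; page numbers of the arXiv pdf).
* §2 (p. 4): substrate `L⁻ = ℤ² ∩ {x₂ ≤ 0}`, configurations `C_N = {x₁, …, x_N} ⊂ ℝ² ∩ {x₂ > 0}`,
  energy (2.1) `F_β(C_N) = ½ Σ_{x_i ≠ x_j} v₂(|x_i − x_j|) + β Σ_{x_i ∈ C_N, z ∈ L⁻} v₂(|x_i − z|)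
  + ½ Σ v₃(θ)`, with `v₂(1) = −1` the unique minimum, `v₂ = 0` beyond `r₀ < √2`, `v₃(kπ/2) = 0`
  (p. 4–5): "Given `β > 0` and `N ∈ ℕ`, it will be convenient to consider the normalized energy
  `2(F_β(C_N) + 2N)` which essentially counts the number of missing bonds at the free surface of the
  configuration and the number of bonds between configuration and substrate (plus the angle part, if
  `C_N ⊄ ℤ²`)."  (2.2) `m_β(N) = min_{h ∈ {1,…,N}} (2h + 2(1 − β)⌈N/h⌉)`; (2.3) `h*(β, N)` the
  largest optimal `h`.
* **Theorem 2.1 (Crystallization)** (p. 6). "For all `β > 0` there exists `N_β ∈ ℕ` such that for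
  each `C_N ∈ (ℝ²)^N` with `N ≥ N_β` it holds that `F_β(C_N) ≥ −2N + ½ m_β(N)`.  In case of equality,
  we have `C_N ⊂ ℤ² ∩ {x₂ > 0}` and `#(C_N ∩ {x₂ = 1}) ≥ N/h*(β, N)`."
* **Remark 2.2** (p. 6): minimizers are "convex by rows and columns", every column is
  `{k} × {1, …, α_k}`, and with `l = #{k : ({k} × ℤ) ∩ C_N ≠ ∅}`, `h = #{k : (ℤ × {k}) ∩ C_N ≠ ∅}`,
  "`F_β(C_N) = −2N + ½(2(1 − β)l + 2h)`".  **Remark 2.3** (p. 6): "If `β ≥ 1`, … `h*(β, N) = 1` …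
  minimizers are horizontal integer shifts of the single chain of particles `{(i, 1) : i = 1, …, N}`,
  and the minimal energy is given by `−(N − 1) − βN`."
* **Lemma 4.1 (Upper bound)** (p. 14): for `h ∈ {1, …, N}` with `N = h⌊N/h⌋ + k`, the configuration
  `C̄_N = ({1, …, ⌈N/h⌉ − 1} × {1, …, h}) ∪ ({⌈N/h⌉} × {1, …, k})` (`{1, …, N/h} × {1, …, h}` if `h ∣ N`)
  has normalized energy `2h + 2(1 − β)⌈N/h⌉`.
* p. 16 (after Definition 4.2): "`m_β(N) = min_h H_{β,N}(h) = min_l L_{β,N}(l)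
  = min {E_β(h, l) : h, l ∈ ℕ, h·l ≥ N}`", `E_β(h, l) = 2h + 2(1 − β)l`.
* **Theorem 2.4 / Corollary 2.5** (p. 6–7): the fluctuation law around the reference rectangle is
  `N^{3/4}` for rational `β ∈ (0,1)` and `N^{1/3±δ}` for irrational algebraic `β` (sharp both ways),
  and `N^{−1/2} h*(β, N) → √(1 − β)` (Winterbottom shape) — NOT formalised here (recorded for the
  open-question harvest: "a genuine substrate-driven effect on fluctuation laws", abstract).

## What is formalised (the on-lattice core of Theorem 2.1, Remark 2.2–2.3 and Lemma 4.1)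

For a lattice configuration `C ⊂ ℤ² ∩ {x₂ > 0}` the three-body part vanishes and the substrate term
is `−β · #(C ∩ {x₂ = 1})` (the particle `(k, 1)` has exactly one substrate point at distance `1`,
namely `(k, 0)`; all other substrate points are at distance `≥ √2 > r₀`), so
`2(F_β(C) + 2N) = #Θ₂(C) − 2β·#(C ∩ {x₂ = 1})` by `#Θ₂ + 2b = 4N`
(`card_boundaryPairs_add_card_adjPairs`).  We take this as the definition `fksEnergy β C` of the
normalized energy ON THE LATTICE and prove:
* `rectEnergy_rows_cols_le_fksEnergy`: `fksEnergy β C ≥ 2h + 2(1 − β)l` with `h`, `l` the numbers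
  of occupied rows and columns (`card_le_rows_mul_cols_and_le_card_boundaryPairs`: `hl ≥ #C`,
  `2(h + l) ≤ #Θ₂(C)`), for `β ≥ 0` — the mechanism of Remark 2.2 (iii);
* `exists_rectEnergy_ceil_le_fksEnergy`: hence `fksEnergy β C ≥ 2h + 2(1 − β)⌈N/h⌉` for SOME
  `h ∈ {1, …, N}`, i.e. `≥ m_β(N)` — the lattice half of Theorem 2.1, for every `β ≥ 0` and every `N`;
* `fksEnergy_columnConfig` / `exists_fksEnergy_eq` — Lemma 4.1: for every `h ∈ {1, …, N}` the
  configuration `C̄_N` lies above the substrate, has `N` points and normalized energy exactly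
  `2h + 2(1 − β)⌈N/h⌉`; so the lattice minimum IS `m_β(N)`;
* `fksEnergy_ge_wetting` — Remark 2.3 on the lattice: for `β ≥ 1`, `fksEnergy β C ≥ 2 + 2(1 − β)N`,
  the value of the single chain (`fksEnergy_chain`).

WHAT IS NOT HERE: the off-lattice statement of Theorem 2.1 (that minimizers of (2.1) among all
`C_N ⊂ ℝ² ∩ {x₂ > 0}` are lattice configurations, via stratification), the equality clause
`#(C_N ∩ {x₂ = 1}) ≥ N/h*`, Theorem 2.4 (fluctuations `N^{3/4}` / `N^{1/3}`), Corollary 2.5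
(Winterbottom shape), the number theory of `h*(β, N)` (§4.2, Roth's theorem).
-/

noncomputable section

open Finset

namespace Literature.MathematicalPhysics.StatisticalMechanics

open Literature.Probability.LatticeModels

/-! ### The lattice setting -/

/-- A lattice configuration lies **above the substrate** `L⁻ = ℤ² ∩ {x₂ ≤ 0}`: all its points have
second coordinate `≥ 1` (`C_N ⊂ ℝ² ∩ {x₂ > 0}` intersected with `ℤ²`).
[cite: FriedrichKreutzStefanelli2025, §2 (L⁻ = ℤ² ∩ {x₂ ≤ 0}, C_N ⊂ {x₂ > 0})] -/
def IsAboveSubstrate (C : Finset (Site 2)) : Prop := ∀ x ∈ C, 1 ≤ x 1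

/-- The number of **substrate bonds** of a lattice configuration: its particles in the first layer
`{x₂ = 1}`, each bonded to the substrate point directly below it.
[cite: FriedrichKreutzStefanelli2025, Theorem 2.1 (#(C_N ∩ {x₂ = 1}))] -/
def substrateBonds (C : Finset (Site 2)) : ℕ := #(C.filter fun x => x 1 = 1)

/-- The **normalized energy** `2(F_β(C) + 2N)` of a LATTICE configuration `C ⊂ ℤ² ∩ {x₂ > 0}`: the
number of missing bonds at the free surface minus `2β` times the number of substrate bonds,
`#Θ₂(C) − 2β·#(C ∩ {x₂ = 1})` (for lattice configurations `F_β(C) = −b(C) − β·#(C ∩ {x₂ = 1})` and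
`#Θ₂(C) + 2b(C) = 4N`). [cite: FriedrichKreutzStefanelli2025, §2 (normalized energy 2(F_β(C_N) + 2N)) and Remark 2.2 (iii)] -/
def fksEnergy (β : ℝ) (C : Finset (Site 2)) : ℝ :=
  (#(boundaryPairs C) : ℝ) - 2 * β * (substrateBonds C : ℝ)

/-- `E_β(h, l) = 2h + 2(1 − β)l`, the normalized energy of an `l × h` block touching the substrate.
[cite: FriedrichKreutzStefanelli2025, Definition 4.2 (E_β(h, l))] -/
def rectEnergy (β : ℝ) (h l : ℕ) : ℝ := 2 * (h : ℝ) + 2 * (1 - β) * (l : ℝ)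

/-- Two lattice points of `ℤ²` with equal coordinates are equal. [folklore] -/
private theorem site_two_ext {x y : Site 2} (h0 : x 0 = y 0) (h1 : x 1 = y 1) : x = y := by
  funext i
  fin_cases i
  · exact h0
  · exact h1

/-- The substrate bonds are at most the number of occupied columns (distinct first-layer particles
sit in distinct columns). [cite: FriedrichKreutzStefanelli2025, Remark 2.2 (ii)–(iii)] -/
theorem substrateBonds_le_card_cols (C : Finset (Site 2)) :
    substrateBonds C ≤ #(C.image fun x => x 0) := by
  classical
  unfold substrateBonds
  refine card_le_card_of_injOn (fun x => x 0) (fun x hx => ?_) ?_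
  · exact mem_coe.2 (mem_image_of_mem _ (mem_filter.1 (mem_coe.1 hx)).1)
  · intro x hx y hy hxy
    have hx1 := (mem_filter.1 (mem_coe.1 hx)).2
    have hy1 := (mem_filter.1 (mem_coe.1 hy)).2
    exact site_two_ext hxy (hx1.trans hy1.symm)

/-- The numbers of occupied rows `h` and columns `l` of a finite `C ⊂ ℤ²` satisfy `#C ≤ h·l` and
`2(h + l) ≤ #Θ₂(C)` (the tree's planar Loomis–Whitney inequality and two boundary pairs per line).
[cite: FriedrichKreutzStefanelli2025, §4.1 (proof of Theorem 2.1: l(s₀)·lᵛ ≥ N, F = 2#𝒮)] -/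
theorem card_le_rows_mul_cols_and_le_card_boundaryPairs (C : Finset (Site 2)) :
    #C ≤ #(C.image fun x => x 1) * #(C.image fun x => x 0) ∧
      2 * (#(C.image fun x => x 1) + #(C.image fun x => x 0)) ≤ #(boundaryPairs C) := by
  have h1 : #C ≤ #(dropCoord 0 C) * #(dropCoord 1 C) := card_le_card_dropCoord_mul_two C
  have h2 : 2 * ∑ i : Fin 2, #(dropCoord i C) ≤ #(boundaryPairs C) :=
    two_mul_sum_card_dropCoord_le_card_boundaryPairs C
  simp only [Fin.sum_univ_two] at h2
  rw [card_dropCoord_zero_eq, card_dropCoord_one_eq] at h1 h2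
  exact ⟨h1, h2⟩

/-! ### The lower bound (Theorem 2.1 on the lattice) -/

/-- **The mechanism of [FKS25] Remark 2.2 (iii), as an inequality for every lattice configuration:**
`2(F_β(C) + 2N) ≥ 2h + 2(1 − β)l`, where `h` and `l` are the numbers of occupied rows and columns of
`C` (every row and every column has two free ends, and at most one substrate bond per column),
for `β ≥ 0`. [cite: FriedrichKreutzStefanelli2025, Remark 2.2 (iii) and §4.1] -/
theorem rectEnergy_rows_cols_le_fksEnergy {β : ℝ} (hβ : 0 ≤ β) (C : Finset (Site 2)) :
    rectEnergy β #(C.image fun x => x 1) #(C.image fun x => x 0) ≤ fksEnergy β C := by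
  obtain ⟨-, h2⟩ := card_le_rows_mul_cols_and_le_card_boundaryPairs C
  have hs := substrateBonds_le_card_cols C
  unfold rectEnergy fksEnergy
  have h2' : (2 : ℝ) * ((#(C.image fun x => x 1) : ℝ) + (#(C.image fun x => x 0) : ℝ)) ≤
      (#(boundaryPairs C) : ℝ) := by exact_mod_cast h2
  have hs' : (substrateBonds C : ℝ) ≤ (#(C.image fun x => x 0) : ℝ) := by exact_mod_cast hs
  nlinarith

/-- **[FKS25] Theorem 2.1 on the lattice: `2(F_β(C) + 2N) ≥ m_β(N)`.**  For every `β ≥ 0` and every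
non-empty lattice configuration `C` with `N` points there is `h ∈ {1, …, N}` with
`2(F_β(C) + 2N) ≥ 2h + 2(1 − β)⌈N/h⌉`; since `m_β(N) = min_{h ∈ {1,…,N}} (2h + 2(1 − β)⌈N/h⌉)` (2.2),
this is the printed lower bound restricted to lattice configurations (for `β ≤ 1` take `h` = the
number of occupied rows, for `β ≥ 1` take `h = 1`). [cite: FriedrichKreutzStefanelli2025, Theorem 2.1 with (2.2)] -/
theorem exists_rectEnergy_ceil_le_fksEnergy {β : ℝ} (hβ : 0 ≤ β) (C : Finset (Site 2))
    (hC : C.Nonempty) :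
    ∃ h : ℕ, 1 ≤ h ∧ h ≤ #C ∧
      2 * (h : ℝ) + 2 * (1 - β) * (⌈(#C : ℝ) / h⌉₊ : ℝ) ≤ fksEnergy β C := by
  classical
  have hmain := rectEnergy_rows_cols_le_fksEnergy hβ C
  obtain ⟨h1, -⟩ := card_le_rows_mul_cols_and_le_card_boundaryPairs C
  unfold rectEnergy at hmain
  set r := #(C.image fun x => x 1) with hr
  set l := #(C.image fun x => x 0) with hl
  have hN : 1 ≤ #C := card_pos.mpr hC
  have hr1 : 1 ≤ r := card_pos.mpr (hC.image _)
  have hrN : r ≤ #C := card_image_le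
  have hlN : l ≤ #C := card_image_le
  by_cases hb : β ≤ 1
  · -- `h` = number of rows; `⌈N/h⌉ ≤ l` from `N ≤ h·l`
    refine ⟨r, hr1, hrN, ?_⟩
    have hr0 : (0 : ℝ) < r := by exact_mod_cast hr1
    have hceil : ⌈(#C : ℝ) / r⌉₊ ≤ l := by
      refine Nat.ceil_le.mpr ?_
      rw [div_le_iff₀ hr0]
      exact_mod_cast (by simpa [mul_comm] using h1 : #C ≤ l * r)
    have hceil' : (⌈(#C : ℝ) / r⌉₊ : ℝ) ≤ l := by exact_mod_cast hceil
    have h1b : (0 : ℝ) ≤ 1 - β := by linarith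
    nlinarith
  · -- wetting regime: `h = 1`
    refine ⟨1, le_rfl, hN, ?_⟩
    have hb' : 1 < β := not_le.mp hb
    have hceil : (⌈(#C : ℝ) / (1 : ℕ)⌉₊ : ℝ) = #C := by simp
    rw [hceil]
    have hl' : (l : ℝ) ≤ #C := by exact_mod_cast hlN
    have hr' : (1 : ℝ) ≤ r := by exact_mod_cast hr1
    have key : (1 - β) * (#C : ℝ) ≤ (1 - β) * (l : ℝ) := by
      nlinarith [mul_nonneg (sub_nonneg.mpr hl') (by linarith : (0 : ℝ) ≤ β - 1)]
    push_cast
    nlinarith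

/-- **[FKS25] Remark 2.3 on the lattice (wetting regime `β ≥ 1`).**  For `β ≥ 1` every non-empty
lattice configuration has normalized energy at least `2 + 2(1 − β)N`, the energy of the single chain
`{(i, 1) : i = 1, …, N}` (`F_β = −(N − 1) − βN`, i.e. `2(F_β + 2N) = 2 + 2(1 − β)N`).
[cite: FriedrichKreutzStefanelli2025, Remark 2.3] -/
theorem fksEnergy_ge_wetting {β : ℝ} (hβ : 1 ≤ β) (C : Finset (Site 2)) (hC : C.Nonempty) :
    2 + 2 * (1 - β) * (#C : ℝ) ≤ fksEnergy β C := by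
  classical
  have hmain := rectEnergy_rows_cols_le_fksEnergy (by linarith : (0 : ℝ) ≤ β) C
  unfold rectEnergy at hmain
  have hr1 : (1 : ℝ) ≤ #(C.image fun x => x 1) := by exact_mod_cast card_pos.mpr (hC.image _)
  have hlN : (#(C.image fun x => x 0) : ℝ) ≤ #C := by exact_mod_cast card_image_le
  nlinarith

/-! ### The minimizers (Lemma 4.1): `q` full columns of height `h` and a last column of height `k` -/

/-- The configuration `C̄ = ({1, …, q} × {1, …, h}) ∪ ({q + 1} × {1, …, k})` of [FKS25] Lemma 4.1
(`q = ⌈N/h⌉ − 1` full columns of height `h` on the substrate and a last column of height `k`,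
`N = qh + k`). [cite: FriedrichKreutzStefanelli2025, Lemma 4.1 (C̄_N)] -/
def columnConfig (q h k : ℕ) : Finset (Site 2) :=
  latticeRect q h ∪ Fintype.piFinset fun i : Fin 2 => if (i : ℕ) = 0 then {(q : ℤ) + 1} else Icc (1 : ℤ) k

/-- Membership in `C̄`, in coordinates. [cite: FriedrichKreutzStefanelli2025, Lemma 4.1 (C̄_N)] -/
theorem mem_columnConfig {q h k : ℕ} {z : Site 2} :
    z ∈ columnConfig q h k ↔
      (1 ≤ z 0 ∧ z 0 ≤ q ∧ 1 ≤ z 1 ∧ z 1 ≤ h) ∨ (z 0 = q + 1 ∧ 1 ≤ z 1 ∧ z 1 ≤ k) := by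
  rw [columnConfig, mem_union, mem_latticeRect]
  simp [Fintype.mem_piFinset, Fin.forall_fin_two]

/-- `#C̄ = qh + k`. [cite: FriedrichKreutzStefanelli2025, Lemma 4.1 (N = h⌊N/h⌋ + k)] -/
theorem card_columnConfig (q h k : ℕ) : #(columnConfig q h k) = q * h + k := by
  rw [columnConfig, card_union_of_disjoint, card_latticeRect]
  · simp [Fintype.card_piFinset, Fin.prod_univ_two, Int.card_Icc]
  · rw [Finset.disjoint_left]
    intro z hz hz'
    rw [mem_latticeRect] at hz
    simp only [Fintype.mem_piFinset, Fin.forall_fin_two] at hz'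
    simp at hz'
    omega

/-- `C̄` lies above the substrate. [cite: FriedrichKreutzStefanelli2025, Lemma 4.1 (C̄_N ⊂ {x₂ > 0})] -/
theorem isAboveSubstrate_columnConfig (q h k : ℕ) : IsAboveSubstrate (columnConfig q h k) := by
  intro z hz
  rw [mem_columnConfig] at hz
  omega

/-- `C̄` is line-convex in both directions (its rows and columns are intervals).
[cite: FriedrichKreutzStefanelli2025, Remark 2.2 (i)–(ii)] -/
theorem isLineConvex_columnConfig (q h k : ℕ) (hk : k ≤ h) (i : Fin 2) :
    IsLineConvex i (columnConfig q h k) := by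
  intro x hx y hy hxy z hzx hxz hzy
  rw [mem_columnConfig] at hx hy ⊢
  fin_cases i
  · have h1 : x 1 = y 1 := by simpa [Fin.removeNth] using congrFun hxy 0
    have h2 : z 1 = x 1 := by simpa [Fin.removeNth] using congrFun hzx 0
    have h3 : x 0 ≤ z 0 := by simpa using hxz
    have h4 : z 0 ≤ y 0 := by simpa using hzy
    omega
  · have h1 : x 0 = y 0 := by simpa [Fin.removeNth] using congrFun hxy 0
    have h2 : z 0 = x 0 := by simpa [Fin.removeNth] using congrFun hzx 0
    have h3 : x 1 ≤ z 1 := by simpa using hxz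
    have h4 : z 1 ≤ y 1 := by simpa using hzy
    omega

/-- The occupied columns of `C̄` are `{1, …, q + 1}` (`k ≥ 1`).
[cite: FriedrichKreutzStefanelli2025, Lemma 4.1 (⌈N/h⌉ columns)] -/
theorem image_columnConfig_apply_zero {q h k : ℕ} (hk1 : 1 ≤ k) (hk : k ≤ h) :
    (columnConfig q h k).image (fun z => z 0) = Icc (1 : ℤ) ((q : ℤ) + 1) := by
  ext t
  simp only [mem_image, mem_Icc]
  constructor
  · rintro ⟨z, hz, rfl⟩
    rw [mem_columnConfig] at hz
    omega
  · intro ht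
    refine ⟨![t, 1], ?_, by simp⟩
    rw [mem_columnConfig]
    simp only [Matrix.cons_val_zero, Matrix.cons_val_one]
    omega

/-- The occupied rows of `C̄` are `{1, …, h}` (when `q ≥ 1` or `k = h`).
[cite: FriedrichKreutzStefanelli2025, Lemma 4.1 (h rows)] -/
theorem image_columnConfig_apply_one {q h k : ℕ} (hk : k ≤ h) (hq : 1 ≤ q ∨ k = h) :
    (columnConfig q h k).image (fun z => z 1) = Icc (1 : ℤ) (h : ℤ) := by
  ext t
  simp only [mem_image, mem_Icc]
  constructor
  · rintro ⟨z, hz, rfl⟩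
    rw [mem_columnConfig] at hz
    omega
  · intro ht
    rcases hq with hq | hq
    · refine ⟨![1, t], ?_, by simp⟩
      rw [mem_columnConfig]
      simp only [Matrix.cons_val_zero, Matrix.cons_val_one]
      omega
    · refine ⟨![(q : ℤ) + 1, t], ?_, by simp⟩
      rw [mem_columnConfig]
      simp only [Matrix.cons_val_zero, Matrix.cons_val_one, true_and]
      omega

/-- Every column of `C̄` touches the substrate: its substrate bonds number `q + 1` (`k ≥ 1`, `h ≥ 1`).
[cite: FriedrichKreutzStefanelli2025, Lemma 4.1 and Remark 2.2 (ii)] -/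
theorem substrateBonds_columnConfig {q h k : ℕ} (hk1 : 1 ≤ k) (hk : k ≤ h) :
    substrateBonds (columnConfig q h k) = q + 1 := by
  have hfilter : (columnConfig q h k).filter (fun x => x 1 = 1) =
      Fintype.piFinset fun i : Fin 2 => if (i : ℕ) = 0 then Icc (1 : ℤ) ((q : ℤ) + 1) else {1} := by
    ext z
    rw [mem_filter, mem_columnConfig]
    simp only [Fintype.mem_piFinset, Fin.forall_fin_two]
    simp
    omega
  rw [substrateBonds, hfilter]
  simp [Fintype.card_piFinset, Fin.prod_univ_two, Int.card_Icc]

/-- **The normalized energy of `C̄` is `2h + 2(1 − β)(q + 1)`** (`1 ≤ k ≤ h`, and `q ≥ 1` or `k = h`):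
`h` rows and `q + 1` columns, each an interval, each column with one substrate bond.
[cite: FriedrichKreutzStefanelli2025, Lemma 4.1 (F_β(Ḡ_nat) = 2h + 2(1−β)⌈N/h⌉)] -/
theorem fksEnergy_columnConfig (β : ℝ) {q h k : ℕ} (hk1 : 1 ≤ k) (hk : k ≤ h) (hq : 1 ≤ q ∨ k = h) :
    fksEnergy β (columnConfig q h k) = 2 * (h : ℝ) + 2 * (1 - β) * ((q : ℝ) + 1) := by
  have hbp : #(boundaryPairs (columnConfig q h k)) =
      2 * ∑ i : Fin 2, #(dropCoord i (columnConfig q h k)) :=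
    card_boundaryPairs_eq_two_mul_sum_card_dropCoord_of_isLineConvex _
      (isLineConvex_columnConfig q h k hk)
  simp only [Fin.sum_univ_two] at hbp
  have h0 := card_dropCoord_zero_eq (columnConfig q h k)
  have h1 := card_dropCoord_one_eq (columnConfig q h k)
  have hrows : #((columnConfig q h k).image fun z => z 1) = h := by
    rw [image_columnConfig_apply_one hk hq, Int.card_Icc]; omega
  have hcols : #((columnConfig q h k).image fun z => z 0) = q + 1 := by
    rw [image_columnConfig_apply_zero hk1 hk, Int.card_Icc]; omega
  have hbp' : #(boundaryPairs (columnConfig q h k)) = 2 * (h + (q + 1)) := by omega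
  unfold fksEnergy
  rw [hbp', substrateBonds_columnConfig hk1 hk]
  push_cast
  ring

/-- **[FKS25] Lemma 4.1 on the lattice: the value `2h + 2(1 − β)⌈N/h⌉` is attained.**  For every
`h ∈ {1, …, N}` there is a lattice configuration above the substrate with `N` points (namely `C̄_N`)
whose normalized energy is exactly `2h + 2(1 − β)⌈N/h⌉`; with `exists_rectEnergy_ceil_le_fksEnergy`,
the minimal normalized energy of `N`-point lattice configurations is exactly
`m_β(N) = min_{h ∈ {1,…,N}} (2h + 2(1 − β)⌈N/h⌉)`. [cite: FriedrichKreutzStefanelli2025, Lemma 4.1] -/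
theorem exists_fksEnergy_eq (β : ℝ) {N h : ℕ} (hh : 1 ≤ h) (hhN : h ≤ N) :
    ∃ C : Finset (Site 2), IsAboveSubstrate C ∧ #C = N ∧
      fksEnergy β C = 2 * (h : ℝ) + 2 * (1 - β) * (⌈(N : ℝ) / h⌉₊ : ℝ) := by
  -- `N - 1 = h·q + r`, `r < h`; `P := h·q`, `k := N - P = r + 1 ∈ {1, …, h}`; `⌈N/h⌉ = q + 1`
  set q := (N - 1) / h with hqdef
  obtain ⟨P, hP⟩ : ∃ P, P = h * q := ⟨_, rfl⟩
  have hdm : P + (N - 1) % h = N - 1 := by rw [hP]; exact Nat.div_add_mod (N - 1) h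
  have hmod : (N - 1) % h < h := Nat.mod_lt _ (by omega)
  set k := N - P with hkdef
  have hk1 : 1 ≤ k := by omega
  have hk : k ≤ h := by omega
  have hq : 1 ≤ q ∨ k = h := by
    rcases Nat.eq_zero_or_pos q with hq0 | hq0
    · right
      have : P = 0 := by rw [hP, hq0, mul_zero]
      omega
    · exact Or.inl hq0
  have hceil : ⌈(N : ℝ) / h⌉₊ = q + 1 := by
    have hh0 : (0 : ℝ) < h := by exact_mod_cast hh
    rw [Nat.ceil_eq_iff (by positivity : q + 1 ≠ 0), Nat.add_sub_cancel, lt_div_iff₀ hh0,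
      div_le_iff₀ hh0]
    constructor
    · have : q * h < N := by rw [mul_comm, ← hP]; omega
      exact_mod_cast this
    · have : N ≤ (q + 1) * h := by rw [add_mul, one_mul, mul_comm, ← hP]; omega
      exact_mod_cast this
  refine ⟨columnConfig q h k, isAboveSubstrate_columnConfig q h k, ?_, ?_⟩
  · rw [card_columnConfig, mul_comm, ← hP]; omega
  · rw [fksEnergy_columnConfig β hk1 hk hq, hceil]
    push_cast
    ring

/-- The single chain `{(i, 1) : i = 1, …, N}` on the substrate (`C̄_N` for `h = 1`) has normalized
energy `2 + 2(1 − β)N`, i.e. `F_β = −(N − 1) − βN` — the wetting minimizer of Remark 2.3.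
[cite: FriedrichKreutzStefanelli2025, Remark 2.3] -/
theorem fksEnergy_chain (β : ℝ) {N : ℕ} (hN : 1 ≤ N) :
    fksEnergy β (columnConfig (N - 1) 1 1) = 2 + 2 * (1 - β) * (N : ℝ) ∧
      #(columnConfig (N - 1) 1 1) = N := by
  refine ⟨?_, by rw [card_columnConfig]; omega⟩
  rw [fksEnergy_columnConfig β le_rfl le_rfl (Or.inr rfl)]
  have : ((N - 1 : ℕ) : ℝ) + 1 = N := by
    rw [Nat.cast_sub hN]; push_cast; ring
  rw [this]
  push_cast
  ring

end Literature.MathematicalPhysics.StatisticalMechanics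

end
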